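import Summits.BirchSwinnertonDyer.BirchSwinnertonDyer.Theses.AdditiveKolyvaginRoad
import Summits.BirchSwinnertonDyer.BirchSwinnertonDyer.Theorems.AdditiveKolyvaginRoadManinFrameFromDatum
import Summits.BirchSwinnertonDyer.BirchSwinnertonDyer.Theorems.AdditiveKolyvaginRoadIstarIsogenyInvariance
import Literature.NumberTheory.EllipticCurves.IsogenyIdProofs
import HarnessLib

/-!
# Route `AdditiveKolyvaginRoad`, support item `ManinFrameIstarClass`
# (stmt-BirchSwinnertonDyer-20093): the item READ ON THE CURVE — the class hypothesis discharged
# from the Kodaira type `Iₙ*` of `W` itself (type `Iₙ*` at an odd `p` is a `ℚ`-isogeny invariant)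

Cell `pub/bsd-wall` (D-0120, W-ALL lane 3, row 2), seat `bsd-wall-akr-p2` (prover); `--supports
stmt-BirchSwinnertonDyer-20093`. THEOREMS ONLY (no definition, no named fact, no `sorry`); nothing
is booked.

`AdditiveKolyvaginRoadManinFrameIstarClass.lean` proves the item with its CLASS-quantified hypothesis
(every globally minimal `W' ∼ W` has type `Iₙ*` at the place of `ℤ` under `p`; that file imports the
route and is NOT imported here — theses-cone hygiene: this file re-assembles the frame from the
route-independent machinery `AdditiveKolyvaginRoadManinFrameFromDatum.lean`). By
`AdditiveKolyvaginRoadIstarIsogenyInvariance.lean` (this seat) that hypothesis follows from the type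
of `W` ALONE, unconditionally and without irreducibility: the `p*`-twist of a type-`Iₙ*` curve is
semistable at `p`, twisting commutes with isogenies, semistability is an isogeny invariant, and a
ramified quadratic twist of a `p`-semistable curve has type `Iₘ*` (Tate's algorithm Steps 6–7).
Hence `frame_of_kodairaSymbolAt_eq_Istar`: the Manin-good odd Heegner frame for every AKR pair
`(W, p)`, `p ≥ 5`, `E[p]` irreducible, `r_an = 1`, with `W` of Kodaira type `Iₙ*` at `p` — the
`e = 2` cells (quadratic twists of good curves, `I₀*`; of multiplicative curves, `Iₙ*`, `n ≥ 1`),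
`p ∈ {5, 7}` included — modulo the by-name inputs `hM`, `hAU`, `hC2` and `PublishedInputsAdditiveKoly`
exactly as the item. Dually, for the open residue `ManinFrameResidueClass`
(stmt-BirchSwinnertonDyer-20094), `ManinFrameResidueClass.exists_isIsogenous_forall_ne_Istar_iff`: its
`Iₙ*`-conjunct "some globally minimal `W' ∼ W` has no `Iₙ*` fibre at the place of `ℤ` under `p`" is
EQUIVALENT to "`W` itself has no `Iₙ*` fibre there" — the class quantifier of that conjunct is
removable by name (planner's pen; nothing is restated here).

References: [SilvermanATAEC1994] IV.9.4 Steps 6–7, IV.11.1 table p. 368; [EdixhovenManin1991] §1;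
[Stevens1989] Lemmas (5.2), (5.4); [HoffsteinLuo1997] Theorem (§1); [Darmon2004] Thm. 3.6.
-/

set_option autoImplicit false
-- the Theorems directory repeats the summit name (sibling precedent `SignedBaseChangeAssembly.lean`)
set_option linter.dupNamespace false

noncomputable section

open scoped Classical

open WeierstrassCurve NumberField IsDedekindDomain Rat.HeightOneSpectrum
  Literature.NumberTheory.DiophantineGeometry Literature.NumberTheory.EllipticCurves
  Literature.NumberTheory.EllipticCurves.ModularForms
  Literature.NumberTheory.EllipticCurves.Rank1Residual
  Summit.BirchSwinnertonDyer.BirchSwinnertonDyer.Theorems.ManinFrameFromDatum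

namespace Summit.BirchSwinnertonDyer.BirchSwinnertonDyer.Theorems.ManinFrameIstarClass

open Summit.BirchSwinnertonDyer.BirchSwinnertonDyer.Theses.AdditiveKolyvaginRoad in
/-- **`ManinFrameIstarClass` read on the curve**: for `W/ℚ` globally minimal with `r_an = 1`, `p ≥ 5`
with `E[p]` irreducible, and `W` of Kodaira type `Iₙ*` (some `n ≥ 0`; additive) at a place `v` of
`ℤ` with generator `p`, the Manin-good odd Heegner frame of `ManinGoodOddFrameAdditive` exists:
`exists_oddHeegnerFrame_of_exists_not_dvd ∘ exists_modularParametrizationData_not_dvd_of_istarClass`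
(the term of `maninFrameIstarClass_proof`) with the class hypothesis supplied by
`IstarIsogenyInvariance.istarClass_of_kodairaSymbolAt_eq_Istar`. Modulo the by-name inputs `hM`
(Mazur 1978 Cor. 4.1), `hAU` (Abbes–Ullmo 1996), `hC2` (Česnavičius 2018) and
`PublishedInputsAdditiveKoly` (conjuncts 6, 7), as the item. [cite: SilvermanATAEC1994, IV.9.4 Steps 6–7]
[cite: EdixhovenManin1991, §1 (typescript L96–101)] [cite: HoffsteinLuo1997, Theorem (§1)]
[cite: Darmon2004, Thm. 3.6] -/
theorem frame_of_kodairaSymbolAt_eq_Istar (hM : MazurManinConstantOddPrimes)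
    (hAU : AbbesUllmoManinConstantGoodPrimes) (hC2 : CesnaviciusManinConstantAtTwo)
    (hPub : PublishedInputsAdditiveKoly)
    (W : WeierstrassCurve ℚ) [W.IsElliptic] [W.IsGloballyMinimal] (p : ℕ) [Fact p.Prime]
    [NeZero (W.conductorNorm ℤ)] (hp5 : 5 ≤ p) (hirr : Irr W p)
    (v : HeightOneSpectrum ℤ) (hv : natGenerator v = p) {n : ℕ}
    (hK : W.kodairaSymbolAt v = .Istar n) (hr : W.analyticRank = 1) :
    ∃ (K : Type) (_ : Field K) (_ : NumberField K)
      (Dt : ModularParametrizationData W (W.conductorNorm ℤ))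
      (H : HeegnerDatum (W.conductorNorm ℤ) (NumberField.discr K)) (ι : K →+* ℂ)
      (P : (W.baseChange K).toAffine.Point)
      (Wd : WeierstrassCurve ℚ) (_ : Wd.IsElliptic) (_ : Wd.IsGloballyMinimal) (Cd : VariableChange ℚ),
      IsImaginaryQuadratic K ∧ Odd (NumberField.discr K) ∧ ¬ (p : ℤ) ∣ NumberField.discr K ∧
        SatisfiesHeegnerHypothesis (W.conductorNorm ℤ) K ∧
        WeierstrassCurve.Affine.Point.map ι.toRatAlgHom P = heegnerPointComplex Dt H ∧
        ¬ (p : ℤ) ∣ Dt.c ∧ ¬ p ∣ Units.torsionOrder K ∧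
        (W.quadraticTwist (NumberField.discr K : ℚ)).entireLFunction 1 ≠ 0 ∧
        Cd • W.quadraticTwist (NumberField.discr K : ℚ) = Wd :=
  exists_oddHeegnerFrame_of_exists_not_dvd hPub.2.2.2.2.2.1 hPub.2.2.2.2.2.2.1 W p hr (by omega)
    (exists_modularParametrizationData_not_dvd_of_istarClass hPub.2.2.2.2.2.1 hM hAU hC2 W rfl p
      (by omega) hirr (fun W₀ _ _ hiso ↦
        IstarIsogenyInvariance.istarClass_of_kodairaSymbolAt_eq_Istar (by omega) v hv hK W₀ hiso))

end Summit.BirchSwinnertonDyer.BirchSwinnertonDyer.Theorems.ManinFrameIstarClass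

namespace Summit.BirchSwinnertonDyer.BirchSwinnertonDyer.Theorems.ManinFrameResidueClass

/-- **The `Iₙ*`-conjunct of the residue `ManinFrameResidueClass` (stmt-BirchSwinnertonDyer-20094),
read on the curve**: for `W/ℚ` globally minimal and `p` odd, "some globally minimal `W' ∼ W` has
`W'.kodairaSymbolAt v ≠ Iₙ*` for every `n` and every place `v` of `ℤ` with generator `p`" holds iff
`W` itself has no `Iₙ*` fibre at the place under `p` (⇒: the type `Iₙ*` of `W` would transport to
`W'`, `IstarIsogenyInvariance.exists_kodairaSymbolAt_eq_Istar_of_isIsogenous`; ⇐: `W' = W`,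
`isIsogenous_self`). [cite: SilvermanATAEC1994, IV.9.4 Steps 6–7] -/
theorem exists_isIsogenous_forall_ne_Istar_iff (W : WeierstrassCurve ℚ) [W.IsElliptic]
    [W.IsGloballyMinimal] {p : ℕ} (hp2 : p ≠ 2) :
    (∃ (W' : WeierstrassCurve ℚ) (_ : W'.IsElliptic) (_ : W'.IsGloballyMinimal),
        IsIsogenous W W' ∧ ∀ (v : HeightOneSpectrum ℤ) (n : ℕ), natGenerator v = p →
          W'.kodairaSymbolAt v ≠ .Istar n) ↔
      ∀ (v : HeightOneSpectrum ℤ) (n : ℕ), natGenerator v = p → W.kodairaSymbolAt v ≠ .Istar n := by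
  constructor
  · rintro ⟨W', _, _, hiso, hW'⟩ v n hv hK
    obtain ⟨m, hm⟩ :=
      IstarIsogenyInvariance.exists_kodairaSymbolAt_eq_Istar_of_isIsogenous hiso hp2 v hv hK
    exact hW' v m hv hm
  · intro h
    exact ⟨W, inferInstance, inferInstance, isIsogenous_self W, h⟩

end Summit.BirchSwinnertonDyer.BirchSwinnertonDyer.Theorems.ManinFrameResidueClass

end
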